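/-
Copyright (c) 2026 the pub-hodgecm-mathlib formalisation cell (harness21).  Prover seat hodgecm-mathlib-K2E4-p11 (g6), Track B ∕ K2-LIT, h413 = `stmt-HodgeConjecture-24833`,
line `K2_E1_TraceFormulaBeta`, campaign «5Res ENDGAME BY FAMILIES», ROADCARD §3′ (M2 v2 «SPECTRAL-MEASURE EXHAUSTION») item D1′-A (dealer K2E1-plan (g7) deals (181)∕(187)∕(199)):
the `L∞`-module calculus of the commutant of a bounded operator on `L²(Ω; E)` — Mathlib only.
-/
import Mathlib.MeasureTheory.Function.Holder
import Mathlib.MeasureTheory.Function.LpSpace.Basic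
import Mathlib.MeasureTheory.Integral.Lebesgue.DominatedConvergence
import Mathlib.Analysis.RCLike.Basic
import Mathlib.Topology.Algebra.Polynomial
import Mathlib.Topology.ContinuousMap.Weierstrass
import HarnessLib

/-!
# D1′-A — `K2E1LinftyCommutantCalculusL2`: the commutant of a bounded operator `Q` on `L²(Ω; E)` inside `L∞(Ω)` is an algebra closed under bounded a.e. limits; polynomial calculus;
# `Q M_s = M_s Q` for a bounded real multiplier `s` ⟹ `Q M_{𝟙_{s<c}} = M_{𝟙_{s<c}} Q` (Mathlib only)

Track B ∕ K2-LIT, crux h413 = `stmt-HodgeConjecture-24833`, route of record `HCCMUnconditional`; cell `hodgecm-mathlib`, squad K2, ENGINE E1; ROADCARD §3′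
`K2/K2E1-plan/g7/ROADCARD-5Res-FAMILIES-M2v2.K2E1-plan-g7.md` item D1′ («`Q ∘ M_s = M_s ∘ Q` for `s ∈ S` ⟹ `Q ∘ M_g = M_g ∘ Q` for every bounded `σ(S)`-measurable `g`»), first of two files
(dealer (199) «D1′ design A+B "="; D1′-A first»).  THEOREMS ONLY (no `def`, no `instance`, no `notation`, no `sorry`; default heartbeats); lane `--supports stmt-HodgeConjecture-24833
--as helper` (count-neutral).  Pure measure theory ∕ functional analysis — no automorphic object.

CURRENCY.  Multipliers act on `L²(Ω; E) = Lp E 2 m` through Mathlib's Hölder action `HSMul (Lp 𝕜 ∞ m) (Lp E 2 m) (Lp E 2 m)` (`MeasureTheory/Function/Holder.lean`: `smul_def`,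
`coeFn_lpSMul`, `Lp.norm_smul_le`, `Lp.smul_add`, `Lp.smul_assoc`); a bounded measurable `g : Ω → 𝕜` enters as its class `hg.toLp g`, `hg : MemLp g ∞ m`; «`Q` commutes with `M_φ`» is
the proposition `∀ f : Lp E 2 m, Q (φ • f) = φ • Q f` (no `def`).  ELABORATION NOTE for consumers: state results under the local instance binder `[ENNReal.HolderTriple ∞ 2 2]` (as this
file does; it is an instance, `HolderTriple.instInfty.symm`, discharged automatically at use) — without it Lean's semi-out-param search for the exponent of `φ • f` gets stuck — and pin the
exponent `(r := 2)` ∕ `(r := ∞)` when invoking `Lp.coeFn_lpSMul`.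

THE MATHEMATICS ([ReedSimonI1980, §VII.2–VII.3 (multiplication operators, spectral measures)]; [Rudin1991, Thm 12.22 ∕ §12.24 (commutants and the bounded Borel calculus)];
[MoeglinWaldspurger1995, IV.3.12 (b) — where it is used: a projection commuting with the `R(h)` commutes with the spectral projections of the continuous spectrum]).  Let `Q` be a bounded
operator on `L²(Ω; E)`.  (§1) `(φψ)•f = φ•(ψ•f)`; (§2) if `φₙ → φ₀` a.e. with `‖φₙ‖ ≤ K` a.e., then `φₙ•f → φ₀•f` in `L²` for every `f` (dominated convergence: `‖(φₙ−φ₀)f‖² ≤ (2K)²‖f‖²`);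
(§3) hence the set `𝓒 = {φ ∈ L∞ : Q M_φ = M_φ Q}` is closed under `+`, scalars, products and bounded a.e. limits; (§4) for functions: constants ∈ 𝓒, products, sums, pointwise bounded
limits, and therefore `p(s) ∈ 𝓒` for every real polynomial `p` when the bounded real multiplier `s ∈ 𝓒`; (§5) by Weierstrass (`exists_polynomial_near_of_continuousOn` on `[−K, K]`,
`|s| ≤ K`) polynomials `pₙ` within `1∕(n+1)` of the continuous cut-offs `φₙ(t) = max 0 (min 1 (n(c − t)))` give `pₙ(s) → 𝟙_{s<c}` boundedly everywhere, so **`𝟙_{s<c} ∈ 𝓒`**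
(`commute_toLp_indicator_lt`) — the input of the Dynkin-system step of D1′-B `K2E1CommutantOfMultiplicationFamily`.
* §1 `lpSMul_assoc`.  §2 **`tendsto_lpSMul_of_tendsto_ae`** (dominated convergence for the Hölder action).
* §3 `commute_lpSMul_add ∕ _const_smul ∕ _mul`, **`commute_lpSMul_of_tendsto`**.
* §4 `toLp_mul`, `toLp_const_smul`, `commute_toLp_const ∕ _mul ∕ _add`, **`commute_toLp_of_tendsto`**, `memLp_top_ofReal`, `memLp_top_comp`, **`commute_toLp_polynomial`**.
* §5 `memLp_top_indicator_lt`, `tendsto_cutoff`, **`commute_toLp_indicator_lt`**.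
HONEST LABEL: HC_CM is proved only modulo the 7 printed citations (2 remaining named inputs: hLiu418 = `stmt-HodgeConjecture-24832`, h413 = `stmt-HodgeConjecture-24833`) until rung 0
closes; this file asserts no named fact, closes no socket; count-neutral; letter-free, Mathlib-only.

## References
* [ReedSimonI1980] M. Reed, B. Simon, *Methods of Modern Mathematical Physics I: Functional Analysis* (rev. ed. 1980), §VII.2–VII.3.
* [Rudin1991] W. Rudin, *Functional Analysis* (2nd ed., 1991), Thm 12.22, §12.24.
* [MoeglinWaldspurger1995] C. Mœglin, J.-L. Waldspurger, *Spectral decomposition and Eisenstein series* (1995), IV.3.12.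
-/

set_option autoImplicit false
set_option linter.dupNamespace false  -- the mandated namespace repeats the summit's segment (`HodgeConjecture.HodgeConjecture`)

noncomputable section

open MeasureTheory Set Filter Topology Polynomial
open scoped ENNReal

namespace Summit.HodgeConjecture.HodgeConjecture.Cruxes.H413.K2E1LinftyCommutantCalculusL2

variable {Ω : Type*} [MeasurableSpace Ω] {m : Measure Ω} {𝕜 : Type*} [RCLike 𝕜] {E : Type*} [NormedAddCommGroup E] [NormedSpace 𝕜 E]
variable [ENNReal.HolderTriple ∞ 2 2]

/-! ## §1–§2 The Hölder action of `L∞` on `L²`: associativity and dominated convergence -/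
/-- Associativity of the Hölder `L∞`-action on `L²`: `(φ • ψ) • f = φ • (ψ • f)`. [folklore] -/
theorem lpSMul_assoc (φ ψ : Lp 𝕜 ∞ m) (f : Lp E 2 m) : ((φ • ψ : Lp 𝕜 ∞ m) • f : Lp E 2 m) = φ • (ψ • f) := by
  apply Lp.ext
  filter_upwards [Lp.coeFn_lpSMul (r := 2) (φ • ψ : Lp 𝕜 ∞ m) f, Lp.coeFn_lpSMul (r := ∞) φ ψ, Lp.coeFn_lpSMul (r := 2) φ (ψ • f : Lp E 2 m), Lp.coeFn_lpSMul (r := 2) ψ f] with x h1 h2 h3 h4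
  rw [h1, Pi.smul_apply', h2, Pi.smul_apply', h3, Pi.smul_apply', h4, Pi.smul_apply', smul_eq_mul, mul_smul]

/-- **DOMINATED CONVERGENCE FOR THE HÖLDER ACTION**: if `φₙ → φ₀` a.e. with `‖φₙ‖ ≤ K` a.e., then `φₙ • f → φ₀ • f` in `L²(Ω; E)` for every `f` (`‖(φₙ − φ₀)•f‖₂² = ∫ ‖φₙ − φ₀‖²‖f‖² → 0`,
dominated by `(2K)²‖f‖²`). [cite: ReedSimonI1980, §VII.2] -/
theorem tendsto_lpSMul_of_tendsto_ae {φ : ℕ → Lp 𝕜 ∞ m} {φ₀ : Lp 𝕜 ∞ m} {K : ℝ} (hK : ∀ n, ∀ᵐ x ∂m, ‖φ n x‖ ≤ K)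
    (hlim : ∀ᵐ x ∂m, Tendsto (fun n => φ n x) atTop (𝓝 (φ₀ x))) (f : Lp E 2 m) :
    Tendsto (fun n => (φ n • f : Lp E 2 m)) atTop (𝓝 (φ₀ • f)) := by
  rw [Lp.tendsto_Lp_iff_tendsto_eLpNorm']
  -- the limit multiplier obeys the same bound a.e.
  have hK' : ∀ᵐ x ∂m, ∀ n, ‖φ n x‖ ≤ K := ae_all_iff.2 hK
  have hK₀ : ∀ᵐ x ∂m, ‖φ₀ x‖ ≤ K := by
    filter_upwards [hK', hlim] with x hx hl
    exact le_of_tendsto hl.norm (Eventually.of_forall hx)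
  -- the difference, a.e.
  have hae : ∀ n, (⇑(φ n • f : Lp E 2 m) - ⇑(φ₀ • f : Lp E 2 m)) =ᵐ[m] fun x => (φ n x - φ₀ x) • (f : Ω → E) x := fun n => by
    filter_upwards [Lp.coeFn_lpSMul (r := 2) (φ n) f, Lp.coeFn_lpSMul (r := 2) φ₀ f] with x h1 h2
    rw [Pi.sub_apply, h1, h2, Pi.smul_apply', Pi.smul_apply', sub_smul]
  have h2 : ∀ n, eLpNorm (⇑(φ n • f : Lp E 2 m) - ⇑(φ₀ • f : Lp E 2 m)) 2 m = (∫⁻ x, ‖(φ n x - φ₀ x) • (f : Ω → E) x‖ₑ ^ (2 : ℝ) ∂m) ^ (1 / (2 : ℝ)) := fun n => by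
    rw [eLpNorm_congr_ae (hae n), eLpNorm_eq_lintegral_rpow_enorm_toReal two_ne_zero ENNReal.ofNat_ne_top, ENNReal.toReal_ofNat]
  simp_rw [h2]
  -- dominated convergence
  have hfint : ∫⁻ x, ‖(f : Ω → E) x‖ₑ ^ (2 : ℝ) ∂m < ∞ := by
    have h := (Lp.memLp f).eLpNorm_lt_top
    rw [eLpNorm_eq_lintegral_rpow_enorm_toReal two_ne_zero ENNReal.ofNat_ne_top, ENNReal.toReal_ofNat] at h
    exact (ENNReal.rpow_lt_top_iff_of_pos (by norm_num : (0 : ℝ) < 1 / 2)).1 h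
  set C : ℝ≥0∞ := ENNReal.ofReal K + ENNReal.ofReal K with hC
  have hbound : ∀ n, ∀ᵐ x ∂m, ‖(φ n x - φ₀ x) • (f : Ω → E) x‖ₑ ^ (2 : ℝ) ≤ C ^ (2 : ℝ) * ‖(f : Ω → E) x‖ₑ ^ (2 : ℝ) := fun n => by
    filter_upwards [hK n, hK₀] with x h1 h2
    rw [enorm_smul, ENNReal.mul_rpow_of_nonneg _ _ (by norm_num : (0 : ℝ) ≤ 2)]
    refine mul_le_mul' (ENNReal.rpow_le_rpow ?_ (by norm_num)) le_rfl
    calc ‖φ n x - φ₀ x‖ₑ ≤ ‖φ n x‖ₑ + ‖φ₀ x‖ₑ := enorm_sub_le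
      _ ≤ ENNReal.ofReal K + ENNReal.ofReal K := by
          rw [← ofReal_norm, ← ofReal_norm]
          exact add_le_add (ENNReal.ofReal_le_ofReal h1) (ENNReal.ofReal_le_ofReal h2)
  have hmeas : ∀ n, AEMeasurable (fun x => ‖(φ n x - φ₀ x) • (f : Ω → E) x‖ₑ ^ (2 : ℝ)) m := fun n =>
    ((((Lp.aestronglyMeasurable (φ n)).sub (Lp.aestronglyMeasurable φ₀)).smul (Lp.aestronglyMeasurable f)).enorm.pow_const _)
  have hlim0 : ∀ᵐ x ∂m, Tendsto (fun n => ‖(φ n x - φ₀ x) • (f : Ω → E) x‖ₑ ^ (2 : ℝ)) atTop (𝓝 0) := by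
    filter_upwards [hlim] with x hx
    have h1 : Tendsto (fun n => (φ n x - φ₀ x) • (f : Ω → E) x) atTop (𝓝 0) := by
      rw [← zero_smul 𝕜 ((f : Ω → E) x)]
      exact (tendsto_sub_nhds_zero_iff.2 hx).smul tendsto_const_nhds
    have h2 : Tendsto (fun n => ‖(φ n x - φ₀ x) • (f : Ω → E) x‖ₑ) atTop (𝓝 0) := by
      rw [← enorm_zero (E := E)]
      exact h1.enorm
    have h3 := ((ENNReal.continuous_rpow_const (y := (2 : ℝ))).tendsto (0 : ℝ≥0∞)).comp h2
    rwa [ENNReal.zero_rpow_of_pos (by norm_num : (0 : ℝ) < 2)] at h3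
  have hdc := tendsto_lintegral_of_dominated_convergence' (fun x => C ^ (2 : ℝ) * ‖(f : Ω → E) x‖ₑ ^ (2 : ℝ)) hmeas hbound
    (by rw [lintegral_const_mul' _ _ (ENNReal.rpow_ne_top_of_nonneg (by norm_num) (by rw [hC]; exact ENNReal.add_ne_top.2 ⟨ENNReal.ofReal_ne_top, ENNReal.ofReal_ne_top⟩))]
        exact ENNReal.mul_ne_top (ENNReal.rpow_ne_top_of_nonneg (by norm_num) (ENNReal.add_ne_top.2 ⟨ENNReal.ofReal_ne_top, ENNReal.ofReal_ne_top⟩)) hfint.ne) hlim0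
  rw [lintegral_zero] at hdc
  have h4 := ((ENNReal.continuous_rpow_const (y := (1 / 2 : ℝ))).tendsto (0 : ℝ≥0∞)).comp hdc
  rwa [ENNReal.zero_rpow_of_pos (by norm_num : (0 : ℝ) < 1 / 2)] at h4
/-! ## §3 The commutant of `Q` inside `L∞`: closure properties -/

section Commutant

variable (Q : Lp E 2 m →L[𝕜] Lp E 2 m)

/-- The commutant class is closed under addition. [cite: Rudin1991, Thm 12.22] -/
theorem commute_lpSMul_add {φ ψ : Lp 𝕜 ∞ m} (hφ : ∀ f : Lp E 2 m, Q (φ • f) = φ • Q f) (hψ : ∀ f : Lp E 2 m, Q (ψ • f) = ψ • Q f) (f : Lp E 2 m) :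
    Q ((φ + ψ) • f) = (φ + ψ) • Q f := by
  rw [Lp.smul_add, map_add, hφ, hψ, Lp.smul_add]

/-- The commutant class is closed under scalars. [cite: Rudin1991, Thm 12.22] -/
theorem commute_lpSMul_const_smul (c : 𝕜) {φ : Lp 𝕜 ∞ m} (hφ : ∀ f : Lp E 2 m, Q (φ • f) = φ • Q f) (f : Lp E 2 m) :
    Q ((c • φ) • f) = (c • φ) • Q f := by
  rw [Lp.smul_assoc, map_smul, hφ, Lp.smul_assoc]

/-- The commutant class is closed under products (`(φψ)•f = φ•(ψ•f)`). [cite: Rudin1991, Thm 12.22] -/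
theorem commute_lpSMul_mul {φ ψ : Lp 𝕜 ∞ m} (hφ : ∀ f : Lp E 2 m, Q (φ • f) = φ • Q f) (hψ : ∀ f : Lp E 2 m, Q (ψ • f) = ψ • Q f) (f : Lp E 2 m) :
    Q ((φ • ψ : Lp 𝕜 ∞ m) • f) = (φ • ψ : Lp 𝕜 ∞ m) • Q f := by
  rw [lpSMul_assoc, hφ, hψ, lpSMul_assoc]

/-- **The commutant class is closed under bounded a.e. limits** (`Q` continuous, `φₙ•f → φ₀•f` and `φₙ•Qf → φ₀•Qf`, uniqueness of limits). [cite: ReedSimonI1980, §VII.2] [cite: Rudin1991, §12.24] -/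
theorem commute_lpSMul_of_tendsto {φ : ℕ → Lp 𝕜 ∞ m} {φ₀ : Lp 𝕜 ∞ m} {K : ℝ} (hK : ∀ n, ∀ᵐ x ∂m, ‖φ n x‖ ≤ K)
    (hlim : ∀ᵐ x ∂m, Tendsto (fun n => φ n x) atTop (𝓝 (φ₀ x))) (hφ : ∀ n, ∀ f : Lp E 2 m, Q (φ n • f) = φ n • Q f) (f : Lp E 2 m) :
    Q (φ₀ • f) = φ₀ • Q f := by
  have h1 : Tendsto (fun n => Q (φ n • f : Lp E 2 m)) atTop (𝓝 (Q (φ₀ • f))) := (Q.continuous.tendsto _).comp (tendsto_lpSMul_of_tendsto_ae hK hlim f)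
  have h2 : Tendsto (fun n => Q (φ n • f : Lp E 2 m)) atTop (𝓝 (φ₀ • Q f)) := by
    simp only [hφ]
    exact tendsto_lpSMul_of_tendsto_ae hK hlim (Q f)
  exact tendsto_nhds_unique h1 h2

end Commutant

/-! ## §4 Functions: constants, products, polynomial calculus, indicators of sub-level sets -/

section Functions

variable (Q : Lp E 2 m →L[𝕜] Lp E 2 m)

omit [ENNReal.HolderTriple ∞ 2 2] in
/-- The class of a product of bounded functions is the `L∞`-product of the classes. [folklore] -/
theorem toLp_mul {g₁ g₂ : Ω → 𝕜} (h₁ : MemLp g₁ ∞ m) (h₂ : MemLp g₂ ∞ m) (h₁₂ : MemLp (fun x => g₁ x * g₂ x) ∞ m) :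
    h₁₂.toLp (fun x => g₁ x * g₂ x) = (h₁.toLp g₁ • h₂.toLp g₂ : Lp 𝕜 ∞ m) := by
  apply Lp.ext
  filter_upwards [h₁₂.coeFn_toLp, Lp.coeFn_lpSMul (r := ∞) (h₁.toLp g₁) (h₂.toLp g₂), h₁.coeFn_toLp, h₂.coeFn_toLp] with x hx h' hx₁ hx₂
  rw [hx, h', Pi.smul_apply', hx₁, hx₂, smul_eq_mul]

/-- Constant multipliers act as scalars. [folklore] -/
theorem toLp_const_smul (c : 𝕜) (f : Lp E 2 m) : ((memLp_top_const (μ := m) c).toLp (fun _ : Ω => c) • f : Lp E 2 m) = c • f := by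
  apply Lp.ext
  filter_upwards [Lp.coeFn_lpSMul (r := 2) ((memLp_top_const (μ := m) c).toLp (fun _ : Ω => c)) f, (memLp_top_const (μ := m) c).coeFn_toLp, Lp.coeFn_smul c f] with x h1 h2 h3
  rw [h1, Pi.smul_apply', h2, h3, Pi.smul_apply]

/-- Constants commute (they act as scalars). [folklore] -/
theorem commute_toLp_const (c : 𝕜) (f : Lp E 2 m) : Q ((memLp_top_const (μ := m) c).toLp (fun _ : Ω => c) • f) = (memLp_top_const (μ := m) c).toLp (fun _ : Ω => c) • Q f := by
  rw [toLp_const_smul, map_smul, toLp_const_smul]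

/-- Products of commuting bounded multipliers commute. [cite: Rudin1991, Thm 12.22] -/
theorem commute_toLp_mul {g₁ g₂ : Ω → 𝕜} (h₁ : MemLp g₁ ∞ m) (h₂ : MemLp g₂ ∞ m) (h₁₂ : MemLp (fun x => g₁ x * g₂ x) ∞ m)
    (hQ₁ : ∀ f : Lp E 2 m, Q (h₁.toLp g₁ • f) = h₁.toLp g₁ • Q f) (hQ₂ : ∀ f : Lp E 2 m, Q (h₂.toLp g₂ • f) = h₂.toLp g₂ • Q f) (f : Lp E 2 m) :
    Q (h₁₂.toLp (fun x => g₁ x * g₂ x) • f) = h₁₂.toLp (fun x => g₁ x * g₂ x) • Q f := by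
  rw [toLp_mul h₁ h₂ h₁₂]
  exact commute_lpSMul_mul Q hQ₁ hQ₂ f

/-- Sums of commuting bounded multipliers commute. [cite: Rudin1991, Thm 12.22] -/
theorem commute_toLp_add {g₁ g₂ : Ω → 𝕜} (h₁ : MemLp g₁ ∞ m) (h₂ : MemLp g₂ ∞ m)
    (hQ₁ : ∀ f : Lp E 2 m, Q (h₁.toLp g₁ • f) = h₁.toLp g₁ • Q f) (hQ₂ : ∀ f : Lp E 2 m, Q (h₂.toLp g₂ • f) = h₂.toLp g₂ • Q f) (f : Lp E 2 m) :
    Q ((h₁.add h₂).toLp (g₁ + g₂) • f) = (h₁.add h₂).toLp (g₁ + g₂) • Q f := by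
  rw [MemLp.toLp_add h₁ h₂]
  exact commute_lpSMul_add Q hQ₁ hQ₂ f

/-- **Bounded pointwise limits of commuting bounded multipliers commute** (function form of `commute_lpSMul_of_tendsto`). [cite: ReedSimonI1980, §VII.2] [cite: Rudin1991, §12.24] -/
theorem commute_toLp_of_tendsto {g : ℕ → Ω → 𝕜} {g₀ : Ω → 𝕜} (hg : ∀ n, MemLp (g n) ∞ m) (hg₀ : MemLp g₀ ∞ m) {K : ℝ} (hK : ∀ n x, ‖g n x‖ ≤ K)
    (hlim : ∀ x, Tendsto (fun n => g n x) atTop (𝓝 (g₀ x))) (hQ : ∀ n, ∀ f : Lp E 2 m, Q ((hg n).toLp (g n) • f) = (hg n).toLp (g n) • Q f) (f : Lp E 2 m) :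
    Q (hg₀.toLp g₀ • f) = hg₀.toLp g₀ • Q f := by
  refine commute_lpSMul_of_tendsto Q (φ := fun n => (hg n).toLp (g n)) (K := K) (fun n => ?_) ?_ hQ f
  · filter_upwards [(hg n).coeFn_toLp] with x hx
    rw [hx]; exact hK n x
  · have hall : ∀ᵐ x ∂m, ∀ n, ((hg n).toLp (g n) : Ω → 𝕜) x = g n x := ae_all_iff.2 fun n => (hg n).coeFn_toLp
    filter_upwards [hall, hg₀.coeFn_toLp] with x hx hx₀
    simp only [hx, hx₀]
    exact hlim x

omit [ENNReal.HolderTriple ∞ 2 2] in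
/-- A bounded measurable real multiplier, embedded in `𝕜`, is in `L∞`. [folklore] -/
theorem memLp_top_ofReal {s : Ω → ℝ} (hsm : Measurable s) {K : ℝ} (hsK : ∀ x, |s x| ≤ K) : MemLp (fun x => ((s x : ℝ) : 𝕜)) ∞ m :=
  memLp_top_of_bound (RCLike.continuous_ofReal.comp_aestronglyMeasurable hsm.aestronglyMeasurable) K (Eventually.of_forall fun x => by
    rw [RCLike.norm_ofReal]; exact hsK x)

omit [ENNReal.HolderTriple ∞ 2 2] in
/-- A continuous function of a bounded measurable real multiplier is a bounded measurable multiplier (bound on `[−K, K]`). [folklore] -/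
theorem memLp_top_comp {s : Ω → ℝ} (hsm : Measurable s) {K : ℝ} (hsK : ∀ x, |s x| ≤ K) {φ : ℝ → ℝ} (hφ : Continuous φ) :
    MemLp (fun x => ((φ (s x) : ℝ) : 𝕜)) ∞ m := by
  obtain ⟨C, hC⟩ := (isCompact_Icc (a := -K) (b := K)).exists_bound_of_continuousOn hφ.continuousOn
  refine memLp_top_of_bound ((RCLike.continuous_ofReal.comp hφ).comp_aestronglyMeasurable hsm.aestronglyMeasurable) C (Eventually.of_forall fun x => ?_)
  rw [RCLike.norm_ofReal]
  exact hC (s x) ⟨neg_le_of_abs_le (hsK x), le_of_abs_le (hsK x)⟩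

/-- **POLYNOMIAL CALCULUS**: if `Q` commutes with the bounded real multiplier `s`, it commutes with `p(s)` for every real polynomial `p` (`Polynomial.induction_on'`: sums, and monomials
`a·sⁿ` by induction on `n` through products). [cite: Rudin1991, Thm 12.22] -/
theorem commute_toLp_polynomial {s : Ω → ℝ} (hsm : Measurable s) {K : ℝ} (hsK : ∀ x, |s x| ≤ K)
    (hQs : ∀ f : Lp E 2 m, Q ((memLp_top_ofReal (𝕜 := 𝕜) (m := m) hsm hsK).toLp (fun x => ((s x : ℝ) : 𝕜)) • f) = (memLp_top_ofReal (𝕜 := 𝕜) (m := m) hsm hsK).toLp (fun x => ((s x : ℝ) : 𝕜)) • Q f)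
    (p : ℝ[X]) (f : Lp E 2 m) :
    Q ((memLp_top_comp (𝕜 := 𝕜) (m := m) hsm hsK p.continuous).toLp (fun x => ((p.eval (s x) : ℝ) : 𝕜)) • f) =
      (memLp_top_comp (𝕜 := 𝕜) (m := m) hsm hsK p.continuous).toLp (fun x => ((p.eval (s x) : ℝ) : 𝕜)) • Q f := by
  induction p using Polynomial.induction_on' generalizing f with
  | add p q hp hq =>
    have hpq : (memLp_top_comp (𝕜 := 𝕜) (m := m) hsm hsK (p + q).continuous).toLp (fun x => (((p + q).eval (s x) : ℝ) : 𝕜)) =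
        ((memLp_top_comp (𝕜 := 𝕜) (m := m) hsm hsK p.continuous).add (memLp_top_comp (𝕜 := 𝕜) (m := m) hsm hsK q.continuous)).toLp
          ((fun x => ((p.eval (s x) : ℝ) : 𝕜)) + fun x => ((q.eval (s x) : ℝ) : 𝕜)) := by
      refine MemLp.toLp_congr _ _ (Eventually.of_forall fun x => ?_)
      simp only [eval_add, RCLike.ofReal_add, Pi.add_apply]
    rw [hpq]
    exact commute_toLp_add Q _ _ hp hq f
  | monomial n a =>
    -- `a * s^n`: induction on `n`
    induction n generalizing f with
    | zero =>
      have h0 : (memLp_top_comp (𝕜 := 𝕜) (m := m) hsm hsK (monomial 0 a).continuous).toLp (fun x => (((monomial 0 a).eval (s x) : ℝ) : 𝕜)) =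
          (memLp_top_const (μ := m) ((a : ℝ) : 𝕜)).toLp (fun _ : Ω => ((a : ℝ) : 𝕜)) := by
        refine MemLp.toLp_congr _ _ (Eventually.of_forall fun x => ?_)
        simp only [eval_monomial, pow_zero, mul_one]
      rw [h0]
      exact commute_toLp_const Q _ f
    | succ n ih =>
      have hS : (memLp_top_comp (𝕜 := 𝕜) (m := m) hsm hsK (monomial (n + 1) a).continuous).toLp (fun x => (((monomial (n + 1) a).eval (s x) : ℝ) : 𝕜)) =
          ((memLp_top_ofReal (𝕜 := 𝕜) (m := m) hsm hsK).smul (memLp_top_comp (𝕜 := 𝕜) (m := m) hsm hsK (monomial n a).continuous) : MemLp _ ∞ m).toLp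
            (fun x => (((monomial n a).eval (s x) : ℝ) : 𝕜) * ((s x : ℝ) : 𝕜)) := by
        refine MemLp.toLp_congr _ _ (Eventually.of_forall fun x => ?_)
        simp only [eval_monomial, pow_succ, ← mul_assoc, RCLike.ofReal_mul, RCLike.ofReal_pow]
      rw [hS]
      exact commute_toLp_mul Q _ _ _ ih hQs f

omit [ENNReal.HolderTriple ∞ 2 2] in
/-- The indicator of a sub-level set of a measurable real function is a bounded measurable multiplier. [folklore] -/
theorem memLp_top_indicator_lt {s : Ω → ℝ} (hsm : Measurable s) (c : ℝ) : MemLp ({x | s x < c}.indicator fun _ : Ω => (1 : 𝕜)) ∞ m :=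
  memLp_top_of_bound (aestronglyMeasurable_const.indicator (measurableSet_lt hsm measurable_const)) 1
    (Eventually.of_forall fun x => (norm_indicator_le_norm_self _ _).trans (by rw [norm_one]))

omit [ENNReal.HolderTriple ∞ 2 2] in
/-- The cut-off profiles `φₙ(t) = max 0 (min 1 (n(c − t)))` converge pointwise to `𝟙_{t < c}` (eventually `1` for `t < c`, identically `0` for `t ≥ c`). [folklore] -/
theorem tendsto_cutoff (c t : ℝ) : Tendsto (fun n : ℕ => max 0 (min 1 ((n : ℝ) * (c - t)))) atTop (𝓝 (if t < c then 1 else 0)) := by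
  by_cases ht : t < c
  · rw [if_pos ht]
    have hct : 0 < c - t := sub_pos.2 ht
    refine tendsto_atTop_of_eventually_const (i₀ := ⌈1 / (c - t)⌉₊) fun n hn => ?_
    have h1 : 1 ≤ (n : ℝ) * (c - t) := by
      have h2 : 1 / (c - t) ≤ n := (Nat.le_ceil _).trans (by exact_mod_cast hn)
      rw [div_le_iff₀ hct] at h2
      exact h2
    rw [min_eq_left h1, max_eq_right zero_le_one]
  · rw [if_neg ht]
    have h0 : ∀ n : ℕ, max 0 (min 1 ((n : ℝ) * (c - t))) = 0 := fun n => by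
      have h1 : (n : ℝ) * (c - t) ≤ 0 := mul_nonpos_of_nonneg_of_nonpos (Nat.cast_nonneg n) (by linarith [not_lt.1 ht])
      exact max_eq_left ((min_le_right _ _).trans h1)
    simp only [h0]
    exact tendsto_const_nhds

/-- **SUB-LEVEL INDICATORS**: if `Q` commutes with the bounded real multiplier `s` (`|s| ≤ K`), it commutes with `𝟙_{s < c}` for every real `c` — Weierstrass polynomials `pₙ` within
`1∕(n+1)` of the cut-offs `φₙ` on `[−K, K]` (Mathlib `exists_polynomial_near_of_continuousOn`) give `pₙ(s) → 𝟙_{s<c}` boundedly (`≤ 2`) everywhere; §4 polynomial calculus and bounded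
limits. [cite: ReedSimonI1980, §VII.2] [cite: Rudin1991, Thm 12.22, §12.24] -/
theorem commute_toLp_indicator_lt {s : Ω → ℝ} (hsm : Measurable s) {K : ℝ} (hsK : ∀ x, |s x| ≤ K)
    (hQs : ∀ f : Lp E 2 m, Q ((memLp_top_ofReal (𝕜 := 𝕜) (m := m) hsm hsK).toLp (fun x => ((s x : ℝ) : 𝕜)) • f) = (memLp_top_ofReal (𝕜 := 𝕜) (m := m) hsm hsK).toLp (fun x => ((s x : ℝ) : 𝕜)) • Q f)
    (c : ℝ) (f : Lp E 2 m) :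
    Q ((memLp_top_indicator_lt (𝕜 := 𝕜) (m := m) hsm c).toLp ({x | s x < c}.indicator fun _ : Ω => (1 : 𝕜)) • f) =
      (memLp_top_indicator_lt (𝕜 := 𝕜) (m := m) hsm c).toLp ({x | s x < c}.indicator fun _ : Ω => (1 : 𝕜)) • Q f := by
  -- the cut-offs and their Weierstrass polynomials on `[−K, K]`
  have hφc : ∀ n : ℕ, Continuous fun t : ℝ => max 0 (min 1 ((n : ℝ) * (c - t))) := fun n =>
    continuous_const.max (continuous_const.min (continuous_const.mul (continuous_const.sub continuous_id)))
  have hW : ∀ n : ℕ, ∃ p : ℝ[X], ∀ t ∈ Set.Icc (-K) K, |p.eval t - max 0 (min 1 ((n : ℝ) * (c - t)))| < 1 / ((n : ℝ) + 1) := fun n =>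
    exists_polynomial_near_of_continuousOn (-K) K _ (hφc n).continuousOn _ Nat.one_div_pos_of_nat
  choose p hp using hW
  have hsI : ∀ x, s x ∈ Set.Icc (-K) K := fun x => ⟨neg_le_of_abs_le (hsK x), le_of_abs_le (hsK x)⟩
  -- pointwise: `pₙ(s x) → 𝟙_{s x < c}`, `|pₙ(s x)| ≤ 2`
  have hlimR : ∀ x, Tendsto (fun n : ℕ => (p n).eval (s x)) atTop (𝓝 (if s x < c then (1 : ℝ) else 0)) := by
    intro x
    have h1 : Tendsto (fun n : ℕ => (p n).eval (s x) - max 0 (min 1 ((n : ℝ) * (c - s x)))) atTop (𝓝 0) := by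
      refine squeeze_zero_norm (fun n => (hp n (s x) (hsI x)).le) tendsto_one_div_add_atTop_nhds_zero_nat
    have h2 := h1.add (tendsto_cutoff c (s x))
    rw [zero_add] at h2
    exact h2.congr fun n => by ring
  have hbd : ∀ n x, ‖(((p n).eval (s x) : ℝ) : 𝕜)‖ ≤ 2 := by
    intro n x
    rw [RCLike.norm_ofReal]
    have h1 := (hp n (s x) (hsI x)).le
    have h2 : |max 0 (min 1 ((n : ℝ) * (c - s x)))| ≤ 1 := by
      rw [abs_of_nonneg (le_max_left _ _)]
      exact max_le zero_le_one (min_le_left _ _)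
    have h3 : 1 / ((n : ℝ) + 1) ≤ 1 := by rw [div_le_one (Nat.cast_add_one_pos n)]; linarith [Nat.cast_nonneg (α := ℝ) n]
    calc |(p n).eval (s x)| = |((p n).eval (s x) - max 0 (min 1 ((n : ℝ) * (c - s x)))) + max 0 (min 1 ((n : ℝ) * (c - s x)))| := by rw [sub_add_cancel]
      _ ≤ |(p n).eval (s x) - max 0 (min 1 ((n : ℝ) * (c - s x)))| + |max 0 (min 1 ((n : ℝ) * (c - s x)))| := abs_add_le _ _
      _ ≤ 1 + 1 := add_le_add (h1.trans h3) h2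
      _ = 2 := by norm_num
  refine commute_toLp_of_tendsto Q (g := fun n x => (((p n).eval (s x) : ℝ) : 𝕜)) (fun n => memLp_top_comp (𝕜 := 𝕜) (m := m) hsm hsK (p n).continuous)
    (memLp_top_indicator_lt (𝕜 := 𝕜) (m := m) hsm c) hbd (fun x => ?_) (fun n => commute_toLp_polynomial Q hsm hsK hQs (p n)) f
  have h := ((RCLike.continuous_ofReal (K := 𝕜)).tendsto _).comp (hlimR x)
  have hval : (((if s x < c then (1 : ℝ) else 0 : ℝ)) : 𝕜) = {x | s x < c}.indicator (fun _ : Ω => (1 : 𝕜)) x := by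
    by_cases hx : s x < c
    · rw [if_pos hx, Set.indicator_of_mem (show x ∈ {x | s x < c} from hx), RCLike.ofReal_one]
    · rw [if_neg hx, Set.indicator_of_notMem (show x ∉ {x | s x < c} from hx), RCLike.ofReal_zero]
  rw [← hval]
  exact h


end Functions

end Summit.HodgeConjecture.HodgeConjecture.Cruxes.H413.K2E1LinftyCommutantCalculusL2

end
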